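import Literature.NumberTheory.EllipticCurves.Sprung2024.ChromaticEulerCharAssemblyProofs
import Literature.NumberTheory.EllipticCurves.Sprung2024.ChromaticCoinvariantsCard
import Literature.NumberTheory.EllipticCurves.Sprung2024.ChromaticCharValueRankZeroAllN
import Literature.NumberTheory.EllipticCurves.Sprung2024.ChromaticLocalInjectivityProofs
import Literature.NumberTheory.EllipticCurves.Sprung2012.LocalTowerNoPTorsionProofs
import HarnessLib

/-!
# Sprung 2024, §5.2: `lem59[AllN]_sharpFlatCharValue_rankZero` (Lemmas 5.5 · 5.8 · 5.9 multiplied)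
# PROVED modulo Lemma 5.5 alone — the composition of `ChromaticEulerCharAssemblyProofs` with the
# named fact `lem55[AllN]_sharpFlat_coinvariants_card`

`Proofs` file (theorems only: **no definition, no named fact**; axioms standard) next to the
statement files `Sprung2024/ChromaticCharValueRankZero[AllN].lean` (named facts `lem59[AllN]_…`:
F. Sprung, Adv. Math. **449** (2024) 109741 [Sprung2024], §5.2 "Proof of Theorem 5.3", p. 41: "The
theorem now follows using Lemma 5.9 and multiplying the terms in Lemma 5.8 and Lemma 5.5, and noting
that since `E[p]` is irreducible as a Galois representation, we necessarily have `|E(ℚ)_p| = 1`") and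
`Sprung2024/ChromaticCoinvariantsCard.lean` (named facts `lem55[AllN]_sharpFlat_coinvariants_card` =
Lemma 5.5 alone: "`1/|(Sel⋆(E,ℚ_∞))_Γ| = (∏_{l bad} c_l^{(p)} / #E(ℚ)_p) × 1/|ker g|`").

WHAT IS PROVED. With Lemmas 5.8 and 5.9 kernel theorems for the tree's chromatic objects
(`ChromaticEulerCharAssemblyProofs`: `f(0) · #(Sel⋆_∞)_γ = u · #Sel_{p^∞}(E/ℚ) · #(A⋆_0/Sel_0)` at a
good supersingular `p ≠ 2`, given `Sel_{p^∞}(E/ℚ)` and `A⋆_0/Sel_0 = ker g` finite), the printed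
multiplication is carried out in the kernel:

* `lem59AllN_of_lem55AllNcard_of_lem55AllN` :
  **`lem55AllN_sharpFlat_coinvariants_card → lem55AllN_sharpFlat_localKerOver_of_layerToInfty_mem →
  lem59AllN_sharpFlatCharValue_rankZero`** — Lemma 5.5 (the count of `(Sel⋆_∞)_Γ`) and its `v = p`
  clause "`r_p` is injective" (which makes `ker g = A⋆_0/Sel_0` finite: g5's
  `finite_quotient_selmerLayer_zero_of_localResOver_eq_zero`, Greenberg's Lemma 3.3 away from `p`)
  give the ♯/♭ Euler characteristic for every conductor; `lem59_of_lem55card_of_lem55` is the printed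
  square-free form;
* `lem59AllN_of_lem55AllNcard_of_prop73_prop76` : the same with the `v = p` clause supplied by g6's
  kernel road `lem55AllN_of_colemanSurjective` from Sprung 2012 Props. 7.3 / 7.6 (Lemma 2.3 being the
  tree theorem `Sprung2012.lem23_localTowerPoints_noPTorsion_holds`):
  **`prop73 → prop76 → lem55AllN_…_card → lem59AllN`**;
* `lem55_sharpFlat_coinvariants_card_of_allN` (EDGE: all-conductor form ⟹ printed form).

So the route's support K3 (`SharpFlatCharValueRankZeroAllLevels` = `lem59AllN_…` by name, item
stmt-BirchSwinnertonDyer-19878 of cell `bsd-ssimc`'s crux 5 `SprungLowerHalfAtThree`) is a kernel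
theorem modulo {Sprung 2024 Lemma 5.5 (all `N`), Sprung 2012 Props. 7.3 / 7.6} — the flag
`Sprung24-§5.2-allN-via-RaySprung25` now rides on Lemma 5.5 only. HONEST FRAMING (seat
`bsd-ssimc-k3c5-kdot-split` g7, object «KDOT-L59-ASSEMBLY»): no `_holds` (the inputs are named
facts); nothing about any curve is asserted; no census cell moves; BSD is not proved by any of this.

## References
* [Sprung2024] §5.2 Lemmas 5.5, 5.8, 5.9 and "Proof of Theorem 5.3" (pp. 40–41); arXiv:1610.10017
  §4 Lemmas 4.4, 4.5, 4.8 (pp. 15–16).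
* [RaySprung2025] J. Ray, F. I. Sprung, Ann. Inst. Fourier 75 (2025), p. 2343.
* [GreenbergLNM1716] R. Greenberg, LNM 1716 (1999), §3 Lemma 3.3, §4 Thm. 4.1 and Lemmas 4.2–4.7.
* [Sprung2012] F. Sprung, J. Number Theory 132 (2012), Prop. 7.3, Prop. 7.6, Lemma 2.3.
-/

noncomputable section

open scoped Classical NumberField

open NumberField IsDedekindDomain WeierstrassCurve Literature.NumberTheory.EllipticCurves
  Literature.NumberTheory.EllipticCurves.ZpExtension Literature.NumberTheory.EllipticCurves.Sprung2017
  Literature.NumberTheory.EllipticCurves.Sprung2012 Literature.NumberTheory.EllipticCurves.IwasawaDual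
  Literature.NumberTheory.EllipticCurves.IwasawaAlgebra

universe u

namespace Literature.NumberTheory.EllipticCurves.Sprung2024

/-- EDGE (faithfulness record): the all-conductor form of Lemma 5.5 specialises to the printed §5.2
form with its standing square-free hypothesis (`W.IsSemistable (𝓞 ℚ)` is simply not used).
[cite: Sprung2024, §5.2 Lemma 5.5 (p. 40)] [cite: RaySprung2025, p. 2343] -/
theorem lem55_sharpFlat_coinvariants_card_of_allN (h : lem55AllN_sharpFlat_coinvariants_card) :
    lem55_sharpFlat_coinvariants_card := by
  intro W _ _ p _ hp2 _ hgood hap hL κ γ hκ hγ hX v hv g hg cneg c hH col hfin hco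
  exact h W p hp2 hgood hap hL κ γ hκ hγ hX v hv g hg cneg c hH col hfin hco

/-- Places of `ℚ` containing the same rational prime coincide (`𝓞 ℚ ≃ ℤ`). [folklore] -/
private theorem heightOneSpectrum_rat_eq_of_natCast_mem' {ℓ : ℕ} (hℓ : ℓ.Prime)
    {v v' : HeightOneSpectrum (𝓞 ℚ)} (hv : (ℓ : 𝓞 ℚ) ∈ v.asIdeal)
    (hv' : (ℓ : 𝓞 ℚ) ∈ v'.asIdeal) : v = v' := by
  have hprime : Prime (ℓ : 𝓞 ℚ) := by
    rw [← MulEquiv.prime_iff (Rat.ringOfIntegersEquiv : 𝓞 ℚ ≃+* ℤ).toMulEquiv]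
    change Prime (Rat.ringOfIntegersEquiv (ℓ : 𝓞 ℚ))
    rw [map_natCast, ← Nat.prime_iff_prime_int]
    exact hℓ
  have hmax : (Ideal.span {(ℓ : 𝓞 ℚ)}).IsMaximal :=
    ((Ideal.span_singleton_prime hprime.ne_zero).mpr hprime).isMaximal
      (by rw [Ne, Ideal.span_singleton_eq_bot]; exact hprime.ne_zero)
  have key : ∀ u : HeightOneSpectrum (𝓞 ℚ), (ℓ : 𝓞 ℚ) ∈ u.asIdeal →
      Ideal.span {(ℓ : 𝓞 ℚ)} = u.asIdeal := fun u hu ↦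
    hmax.eq_of_le u.isPrime.ne_top ((Ideal.span_singleton_le_iff_mem _).mpr hu)
  exact HeightOneSpectrum.ext (by rw [← key v hv, key v' hv'])

/-- **`ker g = A⋆_0/Sel_0` is finite when "`r_p` is injective"** (the `v = p` clause of Lemma 5.5,
in the shape of the body of `lem55AllN_sharpFlat_localKerOver_of_layerToInfty_mem` at the tuple
`(W, p, κ, v, g, c, ⋆)`): the classes of `A⋆_0 = h_0⁻¹(Sel⋆(E/ℚ_∞))` then satisfy the classical local
condition at the (unique) place above `p`, so Greenberg's localisation at `n = 0`
(`finite_quotient_selmerLayer_zero_of_localResOver_eq_zero`: Lemma 3.3 at the bad `v ∤ p`) bounds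
`A⋆_0/Sel_0`. [cite: Sprung2024, §5.2 proof of Lemma 5.5 (p. 40)] [cite: GreenbergLNM1716, §3 Lemmas 3.3, 3.5 (pp. 86–90)] -/
theorem finite_sharpFlatKerG_of_localKerOver_of_layerToInfty_mem
    (W : WeierstrassCurve ℚ) [W.IsElliptic] [W.IsGloballyMinimal] (p : ℕ) [Fact p.Prime]
    (κ : ZpExtension ℚ p) (v : HeightOneSpectrum (𝓞 ℚ)) (hv : (p : 𝓞 ℚ) ∈ v.asIdeal)
    (g : Field.absoluteGaloisGroup (v.adicCompletion ℚ))
    (c : ℕ → localPoints W (v.adicCompletion ℚ)) (col : Chroma)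
    (hloc : ∀ y : W.subgroupH1 p (κ.layerSubgroup 0),
      W.layerToInfty κ 0 y ∈ sharpFlatLocalKummerOverOfEmb W p κ.kerSubgroup
          (closureEmb (K := ℚ) (v.adicCompletion ℚ))
          (localTowerPointsOfEmb κ (closureEmb (K := ℚ) (v.adicCompletion ℚ)) W)
          (colemanKer κ (closureEmb (K := ℚ) (v.adicCompletion ℚ)) W (W.frobeniusTrace p) g c col) →
        y ∈ W.localKerOver p (κ.layerSubgroup 0) (v.adicCompletion ℚ)) :
    Finite (↥((sharpFlatSelmerInfty W κ (closureEmb (K := ℚ) (v.adicCompletion ℚ))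
        (W.frobeniusTrace p) g c col).comap (W.layerToInfty κ 0)) ⧸
      (W.selmerLayer κ 0).addSubgroupOf
        ((sharpFlatSelmerInfty W κ (closureEmb (K := ℚ) (v.adicCompletion ℚ))
          (W.frobeniusTrace p) g c col).comap (W.layerToInfty κ 0))) := by
  refine W.finite_quotient_selmerLayer_zero_of_localResOver_eq_zero κ _
    (comap_layerToInfty_sharpFlatSelmerInfty_le_selmerInftyPreimage W κ
      (closureEmb (K := ℚ) (v.adicCompletion ℚ)) (W.frobeniusTrace p) g c col) (fun v' hv' y hy ↦ ?_)
  obtain rfl : v = v' := heightOneSpectrum_rat_eq_of_natCast_mem' (Fact.out : p.Prime) hv hv'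
  have h1 := ((mem_sharpFlatSelmerInfty_iff W κ (closureEmb (K := ℚ) (v.adicCompletion ℚ))
    (W.frobeniusTrace p) g c col _).mp (AddSubgroup.mem_comap.mp hy)).2 1
  rw [W.conjH1_one_holds p κ.kerSubgroup, AddMonoidHom.id_apply] at h1
  exact (W.mem_localKerOver_iff p (κ.layerSubgroup 0) (v.adicCompletion ℚ) y).mp (hloc y h1)

/-- **Sprung 2024 §5.2 "Proof of Theorem 5.3" (p. 41) as a kernel computation: Lemma 5.5 (named) ×
Lemmas 5.8 · 5.9 (kernel, `ChromaticEulerCharAssemblyProofs`) ⟹ `lem59AllN_…`.** Precisely: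
**`lem55AllN_sharpFlat_coinvariants_card → lem55AllN_sharpFlat_localKerOver_of_layerToInfty_mem →
lem59AllN_sharpFlatCharValue_rankZero`.** For the data of `lem59AllN_…`: "`r_p` is injective"
(`h55p`) makes `ker g = A⋆_0/Sel_0` finite (`finite_sharpFlatKerG_of_localKerOver_of_layerToInfty_mem`);
with `Sel_{p^∞}(E/ℚ)` finite, `constantCoeff_charGenerator_mul_natCard_sharpFlatEndCoinvariants_rat`
gives `(Sel⋆_∞)_γ` finite and `f(0) · #(Sel⋆_∞)_γ = u · #Sel_{p^∞}(E/ℚ) · #ker g`; Lemma 5.5 (`h55`)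
gives `#ker g · #E(ℚ)_p = p^{ord_p ∏ c_l} · #(Sel⋆_∞)_γ` with `#E(ℚ)_p = 1`
(`natCard_fixedPoints_geomPrimaryTorsion_eq_one_of_supersingular`); cancelling the non-zero integer
`#(Sel⋆_∞)_γ` in `ℤ_p`: `f(0) = u · p^{ord_p ∏ c_l} · #Sel_{p^∞}(E/ℚ)`. No `_holds` (both inputs are
named facts). [cite: Sprung2024, §5.2 Proof of Thm. 5.3 (p. 41) and Lemmas 5.5, 5.8, 5.9]
[cite: RaySprung2025, p. 2343] [cite: GreenbergLNM1716, §4 Thm. 4.1 (proof, pp. 102–108)] -/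
theorem lem59AllN_of_lem55AllNcard_of_lem55AllN (h55 : lem55AllN_sharpFlat_coinvariants_card)
    (h55p : lem55AllN_sharpFlat_localKerOver_of_layerToInfty_mem) :
    lem59AllN_sharpFlatCharValue_rankZero := by
  intro W _ _ p _ hp2 hgood hap hL κ γ hκ hγ hX v hv g hg cneg c hH col D _ htor f hf hfin
  -- `ker g = A⋆_0/Sel_0` is finite ("`r_p` is injective")
  have hkerg := finite_sharpFlatKerG_of_localKerOver_of_layerToInfty_mem W p κ v hv g c col
    (h55p W p hp2 hgood hap κ hκ v hv g hg cneg c hH col)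
  -- Lemmas 5.8 × 5.9 (kernel)
  obtain ⟨-, hco, -, u, hu⟩ := constantCoeff_charGenerator_mul_natCard_sharpFlatEndCoinvariants_rat
    W p hp2 hgood hap κ hγ v hg hH col D htor f hf hfin hkerg
  -- Lemma 5.5 (named), with `#E(ℚ)_p = 1`
  have h5 := h55 W p hp2 hgood hap hL κ γ hκ hγ hX v hv g hg cneg c hH col hfin hco
  rw [natCard_fixedPoints_geomPrimaryTorsion_eq_one_of_supersingular W p hp2 hgood hap, mul_one] at h5
  -- cancel `#(Sel⋆_∞)_γ ≠ 0` in `ℤ_p`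
  set m := Nat.card (EndCoinvariants (conjSharpFlatSelmerInfty W κ
    (closureEmb (K := ℚ) (v.adicCompletion ℚ)) (W.frobeniusTrace p) g c col γ - 1)) with hm
  haveI := hco
  have hm0 : (m : ℤ_[p]) ≠ 0 := by exact_mod_cast (Nat.card_pos (α := EndCoinvariants
    (conjSharpFlatSelmerInfty W κ (closureEmb (K := ℚ) (v.adicCompletion ℚ)) (W.frobeniusTrace p) g c
      col γ - 1))).ne'
  have h5' : (Nat.card (↥((sharpFlatSelmerInfty W κ (closureEmb (K := ℚ) (v.adicCompletion ℚ))
      (W.frobeniusTrace p) g c col).comap (W.layerToInfty κ 0)) ⧸ (W.selmerLayer κ 0).addSubgroupOf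
        ((sharpFlatSelmerInfty W κ (closureEmb (K := ℚ) (v.adicCompletion ℚ)) (W.frobeniusTrace p) g c
          col).comap (W.layerToInfty κ 0))) : ℤ_[p]) =
      (p : ℤ_[p]) ^ padicValNat p W.tamagawaProduct * (m : ℤ_[p]) := by
    exact_mod_cast h5
  rw [h5'] at hu
  have key : PowerSeries.constantCoeff f =
      (u : ℤ_[p]) * (p : ℤ_[p]) ^ padicValNat p W.tamagawaProduct * Nat.card (W.selmerGroupPInfty p) := by
    apply mul_right_cancel₀ hm0
    rw [hu]
    ring
  refine ⟨u, ?_⟩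
  rw [key]
  push_cast
  ring

/-- **The printed §5.2 form: `lem55_sharpFlat_coinvariants_card → lem55_sharpFlat_localKerOver_… →
lem59_sharpFlatCharValue_rankZero`** (square-free conductor carried and unused).
[cite: Sprung2024, §5.2 Proof of Thm. 5.3 (p. 41) and Lemmas 5.5, 5.8, 5.9] -/
theorem lem59_of_lem55card_of_lem55 (h55 : lem55_sharpFlat_coinvariants_card)
    (h55p : lem55_sharpFlat_localKerOver_of_layerToInfty_mem) :
    lem59_sharpFlatCharValue_rankZero := by
  intro W _ _ p _ hp2 hss hgood hap hL κ γ hκ hγ hX v hv g hg cneg c hH col D _ htor f hf hfin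
  have hkerg := finite_sharpFlatKerG_of_localKerOver_of_layerToInfty_mem W p κ v hv g c col
    (h55p W p hp2 hss hgood hap κ hκ v hv g hg cneg c hH col)
  obtain ⟨-, hco, -, u, hu⟩ := constantCoeff_charGenerator_mul_natCard_sharpFlatEndCoinvariants_rat
    W p hp2 hgood hap κ hγ v hg hH col D htor f hf hfin hkerg
  have h5 := h55 W p hp2 hss hgood hap hL κ γ hκ hγ hX v hv g hg cneg c hH col hfin hco
  rw [natCard_fixedPoints_geomPrimaryTorsion_eq_one_of_supersingular W p hp2 hgood hap, mul_one] at h5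
  set m := Nat.card (EndCoinvariants (conjSharpFlatSelmerInfty W κ
    (closureEmb (K := ℚ) (v.adicCompletion ℚ)) (W.frobeniusTrace p) g c col γ - 1)) with hm
  haveI := hco
  have hm0 : (m : ℤ_[p]) ≠ 0 := by exact_mod_cast (Nat.card_pos (α := EndCoinvariants
    (conjSharpFlatSelmerInfty W κ (closureEmb (K := ℚ) (v.adicCompletion ℚ)) (W.frobeniusTrace p) g c
      col γ - 1))).ne'
  have h5' : (Nat.card (↥((sharpFlatSelmerInfty W κ (closureEmb (K := ℚ) (v.adicCompletion ℚ))
      (W.frobeniusTrace p) g c col).comap (W.layerToInfty κ 0)) ⧸ (W.selmerLayer κ 0).addSubgroupOf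
        ((sharpFlatSelmerInfty W κ (closureEmb (K := ℚ) (v.adicCompletion ℚ)) (W.frobeniusTrace p) g c
          col).comap (W.layerToInfty κ 0))) : ℤ_[p]) =
      (p : ℤ_[p]) ^ padicValNat p W.tamagawaProduct * (m : ℤ_[p]) := by
    exact_mod_cast h5
  rw [h5'] at hu
  have key : PowerSeries.constantCoeff f =
      (u : ℤ_[p]) * (p : ℤ_[p]) ^ padicValNat p W.tamagawaProduct * Nat.card (W.selmerGroupPInfty p) := by
    apply mul_right_cancel₀ hm0
    rw [hu]
    ring
  refine ⟨u, ?_⟩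
  rw [key]
  push_cast
  ring

/-- **`prop73 → prop76 → lem55AllN_sharpFlat_coinvariants_card → lem59AllN_sharpFlatCharValue_rankZero`**:
the `v = p` clause supplied by g6's kernel road `lem55AllN_of_colemanSurjective` from Sprung 2012
Prop. 7.3 ("`Col♭` is surjective"), Prop. 7.6 (`η = 1`: "`Col♯` is surjective") and Lemma 2.3 (a tree
theorem, `Sprung2012.lem23_localTowerPoints_noPTorsion_holds`). On the cell's crux-5 road
(`Theorems.…SplitConverseColeman`) Props. 7.3/7.6 are inputs already, so K3 costs Lemma 5.5 alone.
[cite: Sprung2024, §5.2 Proof of Thm. 5.3 (p. 41)] [cite: Sprung2012, Prop. 7.3 (p. 1500), Prop. 7.6 (p. 1501), Lemma 2.3 (p. 1487)] -/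
theorem lem59AllN_of_lem55AllNcard_of_prop73_prop76 (h55 : lem55AllN_sharpFlat_coinvariants_card)
    (h73 : prop73_colemanFlat_surjective) (h76 : prop76_colemanSharp_surjective) :
    lem59AllN_sharpFlatCharValue_rankZero :=
  lem59AllN_of_lem55AllNcard_of_lem55AllN h55
    (lem55AllN_of_colemanSurjective h73 h76 lem23_localTowerPoints_noPTorsion_holds)

/-- The printed form of the previous theorem: `prop73 → prop76 → lem55AllN_…_card → lem59_…`
(through the edges `lem59_…_of_allN`). [cite: Sprung2024, §5.2 Proof of Thm. 5.3 (p. 41)]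
[cite: Sprung2012, Prop. 7.3 (p. 1500), Prop. 7.6 (p. 1501)] -/
theorem lem59_of_lem55AllNcard_of_prop73_prop76 (h55 : lem55AllN_sharpFlat_coinvariants_card)
    (h73 : prop73_colemanFlat_surjective) (h76 : prop76_colemanSharp_surjective) :
    lem59_sharpFlatCharValue_rankZero :=
  lem59_sharpFlatCharValue_rankZero_of_allN (lem59AllN_of_lem55AllNcard_of_prop73_prop76 h55 h73 h76)

end Literature.NumberTheory.EllipticCurves.Sprung2024

end
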